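/-
Copyright (c) 2026. All rights reserved.
Released under Apache 2.0 license as described in the file LICENSE.
Authors: abc-iut cell, wave-6 cone prover seat abc-iut-w6-d025 (gen 5; L4-lead m151 (4) row «TWO-SIDED-SUM», file 2/2), over
this seat's `LogFrobeniusSettingSum.lean`, abc-iut-L4-t3's add-ons (`MonoTelecoreCoherence`, `IotaAnMono`, `EtaNatural`),
abc-iut-f-101's pinned Cor 5.10 (iv)(b)(c) sufficiency and genuine open-augmentation instances, and this lineage's
`archGenuineMonoAnChart`.
-/
import Literature.AnabelianGeometry.AbsoluteAnabelian.Ltimes.LogFrobeniusSettingSum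
import Literature.AnabelianGeometry.AbsoluteAnabelian.Ltimes.LogFrobeniusIotaEtaSquare
import Literature.AnabelianGeometry.AbsoluteAnabelian.Ltimes.LogFrobeniusMonoTelecoreContact
import HarnessLib

/-!
# [AbsTopIII] Cor 5.10 (iv)(b)(c) for the SUM of two settings: the coherence add-on from the factors SEPARATELY, the pinned
# telecore/contact clauses, the `η⊢`-square — and genuine instances (two residue characteristics; nonarchimedean ⊔ archimedean)

S. Mochizuki, *Topics in absolute anabelian geometry III*, J. Math. Sci. Univ. Tokyo 22 (2015) [MochizukiAbsTopIII2015];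
manuscript `paper:url-5493eb38cbb7`: Prop 5.8 (vii) pp. 141–142 ("`w ∈ W_non` (respectively, `w ∈ W_arc`)"), Cor 5.10 (iv)(b)(c)
pp. 147–148 (the mono-analytic telecore `𝔗_{An⊢}`, the contact structure `ℋ_{An⊢}`, "isomorphisms `η⊢_{v,ν}`" for EACH
`v ∈ V(F_mod)`), Def 3.5 (ii) p. 75 (one family of homotopies).

## What this file builds (row «TWO-SIDED-SUM», file 2/2; PROOFS + the three small instance definitions)

Over `Lt₁.sum Lt₂` (file 1: global categories the products, each place its own factor's local row):

* ★ `sumMonoTelecoreCoherence K₁ K₂ : (Lt₁.sum Lt₂).MonoTelecoreCoherence (sumMonoAnalyticizationHomotopies M₁ M₂)` — from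
  coherence data of the factors SEPARATELY, each over ITS OWN index set: at `inl v`, «`ψ` over `ℰ⊢`» is `hψ₁ × 𝟙`, the printed
  `η⊢_{v,ν}` is `η₁,v × (unit of κ₂)⁻¹` on the carried object, and the coherence «`η⊢` over `ℰ⊢`» holds componentwise;
* ★ `sum_cor510MonoTelecorePinned` — the PINNED Cor 5.10 (iv)(b)(c) for the sum (abc-iut-f-101's sufficiency theorem
  `MonoTelecoreCoherence.cor510MonoTelecorePinned` BY NAME);
* `sum_iotaPre_app_inl/_inr`, `sum_gammaZeroApp_inl/_inr`, `sum_gammaOneApp_inl/_inr` (component computations) and ★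
  `etaNatural_sum : K₁.EtaNatural I₁ → K₂.EtaNatural I₂ → (sumMonoTelecoreCoherence K₁ K₂).EtaNatural (sumIotaData I₁ I₂)`;
* GENUINE INSTANCES: ★ `twoPrimeOpen p ℓ V₁ V₂ := (genuineOpen p V₁).sum (genuineOpen ℓ V₂)` — nonarchimedean places of TWO
  residue characteristics in ONE setting — with `twoPrimeOpen_monoTelecoreCoherence`, `twoPrimeOpen_cor510MonoTelecorePinned`,
  `twoPrimeOpen_etaNatural` ALL hypothesis-free from abc-iut-f-101 / abc-iut-L4-t3's one-prime theorems
  (`monoTelecoreCoherence_open`, `etaNatural_genuineOpen`); and `genuineTwoSidedSum p 𝔄 V₁ V₂ :=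
  (genuineOpen p V₁).sum (archGenuineMonoAnChart 𝔄 V₂ (fun _ => true))` — genuine nonarchimedean AND archimedean rows in ONE
  setting with NO filler slot — with its mono-analyticization homotopies, Cor 5.10 (iv)(a), the `ι^{An⊢⊞}` add-on, and
  `genuineTwoSidedSum_monoTelecoreCoherence_of (K_arc)`: its coherence the moment an archimedean coherence datum exists
  (the arc `η⊢` content is in tree, abc-iut-w5-d038 `HolTFPair.etaTilde`/`etaTimes`; its packaging as a coherence datum is the
  L4-lead's pending interface ruling m151 (3) — stated here with `K_arc` a BINDER, honestly).

MODEL-LEVEL; honest limits (P1), (P3) of `LogFrobeniusSettingSum.lean`; nothing here bears on [IUTchIII] Cor. 3.12; OUR kernel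
check, no side taken; instantiated ≠ endorsed; typed ≠ proved elsewhere.

**`⋉`-TWIN** (cell row «LTIMES-SUM-CARRIER», L4-lead m184; abc-iut-L4-t8 g12): verbatim re-elaboration of §§1–2 (the GENERIC part) of
`LogFrobeniusSettingSumCoherence.lean` (abc-iut-w6-d025) over `LogFrobeniusSettingLtimes` by the cell recipe (names in `namespace
LogFrobeniusSettingLtimes`, factors `Lt₁`, `Lt₂`; `ι⊞` over `LogEdgeLtimes`); §3 (instances at FROZEN carriers) is dropped per rule 6 —
the `⋉`-carriers live in `Ltimes/LogFrobeniusSettingSumLtimesCarriers.lean`; statements and proofs otherwise unchanged; the original stays.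
-/

set_option autoImplicit false

noncomputable section

open CategoryTheory

universe u

namespace Literature.AnabelianGeometry.AbsoluteAnabelian

namespace LogFrobeniusSettingLtimes

variable {V₁ V₂ : Type u} {isArc₁ : V₁ → Bool} {isArc₂ : V₂ → Bool}
  {Lt₁ : LogFrobeniusSettingLtimes V₁ isArc₁} {Lt₂ : LogFrobeniusSettingLtimes V₂ isArc₂}
  {M₁ : Lt₁.MonoAnalyticizationHomotopies} {M₂ : Lt₂.MonoAnalyticizationHomotopies}

/-! ## §1. The coherence add-on of the sum from the factors' coherence, each over its own index set -/

section Carried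

variable {Vmod : Type u} {isArc : Vmod → Bool} (Lt : LogFrobeniusSettingLtimes Vmod isArc)

/-- The `η⊢`-leg on the CARRIED global object of the other factor: along `□ → 𝒩⊞ → 𝒩 → ℰ• → ℰ⊢ ⥲ An⊢ → 𝒩⊢⊞` it is read
through `proj ⋙ monoAn ⋙ κ ⋙ κ⁻¹`, along `□ → 𝒩⊞ → 𝒩⊢⊞` through `proj ⋙ monoAn`; the canonical isomorphism between the two
is the inverse unit of the equivalence `κ_{An⊢}`. [cite: MochizukiAbsTopIII2015, Cor 5.10 (iv)(c) p. 148] -/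
def carriedEta :
    (𝟭 Lt.X ⋙ 𝟭 Lt.X ⋙ Lt.proj ⋙ Lt.monoAn ⋙ Lt.κAnMono.functor ⋙ Lt.κAnMono.inverse) ≅ (𝟭 Lt.X ⋙ (Lt.proj ⋙ Lt.monoAn)) :=
  NatIso.ofComponents (fun y => (Lt.κAnMono.unitIso.app (Lt.monoAn.obj (Lt.proj.obj y))).symm)
    (fun f => Lt.κAnMono.unitIso.inv.naturality (Lt.monoAn.map (Lt.proj.map f)))

/-- Its components are the inverse unit. [cite: MochizukiAbsTopIII2015, Cor 5.10 (iv)(c) p. 148] -/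
@[simp] theorem carriedEta_hom_app (y : Lt.X) :
    Lt.carriedEta.hom.app y = Lt.κAnMono.unitIso.inv.app (Lt.monoAn.obj (Lt.proj.obj y)) := rfl

/-- … and the unit. [cite: MochizukiAbsTopIII2015, Cor 5.10 (iv)(c) p. 148] -/
@[simp] theorem carriedEta_inv_app (y : Lt.X) :
    Lt.carriedEta.inv.app y = Lt.κAnMono.unitIso.hom.app (Lt.monoAn.obj (Lt.proj.obj y)) := rfl

end Carried

/-- The printed `η⊢_{v,ν}` of the sum at `inl v`: `η₁,v,ν` on the first factor and `carriedEta` on the carried global object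
of the second factor; symmetric at `inr v`. [cite: MochizukiAbsTopIII2015, Cor 5.10 (iv)(c) p. 148] -/
def sumEta (K₁ : Lt₁.MonoTelecoreCoherence M₁) (K₂ : Lt₂.MonoTelecoreCoherence M₂) :
    ∀ (v : V₁ ⊕ V₂) (ν : LogVertex (Sum.elim isArc₁ isArc₂ v)) (hν : ν.IsCross),
      (Lt₁.sum Lt₂).lam v ν ⋙ (Lt₁.sum Lt₂).forget v ⋙ (Lt₁.sum Lt₂).toE v ⋙ (Lt₁.sum Lt₂).monoAn ⋙
          (Lt₁.sum Lt₂).κAnMono.functor ⋙ (Lt₁.sum Lt₂).ψAnMono v ⟨ν, hν⟩ ≅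
        (Lt₁.sum Lt₂).lam v ν ⋙ (Lt₁.sum Lt₂).monoNplus v
  | .inl v, ν, hν => NatIso.prod (K₁.eta v ν hν) Lt₂.carriedEta
  | .inr v, ν, hν => NatIso.prod Lt₁.carriedEta (K₂.eta v ν hν)

/-- ★ **The coherence add-on of the SUM from coherence data of the factors SEPARATELY** (each over its own index set): at each
place the own factor's «`ψ` over `ℰ⊢`», printed `η⊢_{v,ν}` and coherence, and identities / the unit of `κ` on the carried
object. [cite: MochizukiAbsTopIII2015, Cor 5.10 (iv)(c) p. 148] -/
def sumMonoTelecoreCoherence (K₁ : Lt₁.MonoTelecoreCoherence M₁) (K₂ : Lt₂.MonoTelecoreCoherence M₂) :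
    (Lt₁.sum Lt₂).MonoTelecoreCoherence (sumMonoAnalyticizationHomotopies M₁ M₂) where
  psiOver := sumψOverIso K₁.psiOver K₂.psiOver
  eta := sumEta K₁ K₂
  eta_over
    | .inl v, ν, hν, y => by
      refine Prod.ext (K₁.eta_over v ν hν y.1) ?_
      change Lt₂.carriedEta.hom.app y.2 ≫ (𝟙 _ ≫ 𝟙 _) ≫ (Lt₂.proj ⋙ Lt₂.monoAn).rightUnitor.hom.app y.2 =
        𝟙 _ ≫ Lt₂.κAnMono.unitIso.inv.app (Lt₂.monoAn.obj (Lt₂.proj.obj y.2))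
      simp only [carriedEta_hom_app, Category.id_comp, Functor.rightUnitor_hom_app]
      exact Category.comp_id _
    | .inr v, ν, hν, y => by
      refine Prod.ext ?_ (K₂.eta_over v ν hν y.2)
      change Lt₁.carriedEta.hom.app y.1 ≫ (𝟙 _ ≫ 𝟙 _) ≫ (Lt₁.proj ⋙ Lt₁.monoAn).rightUnitor.hom.app y.1 =
        𝟙 _ ≫ Lt₁.κAnMono.unitIso.inv.app (Lt₁.monoAn.obj (Lt₁.proj.obj y.1))
      simp only [carriedEta_hom_app, Category.id_comp, Functor.rightUnitor_hom_app]
      exact Category.comp_id _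

/-- ★ **PINNED Cor 5.10 (iv)(b)(c) for the sum** (`V₁ ⊕ V₂ ≠ ∅`): abc-iut-f-101's sufficiency theorem fed BY NAME with the sum's
coherence add-on. [cite: MochizukiAbsTopIII2015, Cor 5.10 (iv)(b)(c) pp. 147–148] -/
theorem sum_cor510MonoTelecorePinned [Nonempty (V₁ ⊕ V₂)] (K₁ : Lt₁.MonoTelecoreCoherence M₁)
    (K₂ : Lt₂.MonoTelecoreCoherence M₂) : (Lt₁.sum Lt₂).Cor510MonoTelecorePinned :=
  (sumMonoTelecoreCoherence K₁ K₂).cor510MonoTelecorePinned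

/-! ## §2. The `η⊢`-square is inherited by the sum -/

section EtaSquare

variable (Lt₁ Lt₂)

/-- At a pre-log source the canonical `Λ ⟶ 𝟭` is an `eqToHom`. [cite: MochizukiAbsTopIII2015, Def 5.4 (vii) p. 128] -/
theorem twistToId_eq_eqToHom {Vmod : Type u} {isArc : Vmod → Bool} (Lt : LogFrobeniusSettingLtimes Vmod isArc) (c : Bool)
    (hc : c = false) : Lt.twistToId c = eqToHom (by rw [hc]; rfl) := by
  subst hc
  rfl

/-- `ι⊞` of a factor = cast ≫ untwisted `ι⊞`. [cite: MochizukiAbsTopIII2015, Def 5.4 (vii) p. 128] -/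
theorem iota_eq_eqToHom_comp_iotaPre' {Vmod : Type u} {isArc : Vmod → Bool} (Lt : LogFrobeniusSettingLtimes Vmod isArc) (v : Vmod)
    {ν₁ ν₂ : LogVertex (isArc v)} (ε : LogEdgeLtimes (isArc v) ν₁ ν₂) (h₁ : ν₁.isPostLog = false) :
    Lt.iota v ε = eqToHom (Lt.twist_comp_lam_eq v ν₁ h₁) ≫ Lt.iotaPre v ε h₁ := by
  rw [iotaPre, eqToHom_trans_assoc, eqToHom_refl, Category.id_comp]

/-- Product of two cast-prefixed transformations. [folklore] -/
private theorem natTransProd_eqToHom_comp {A B C D : Type*} [Category A] [Category B] [Category C] [Category D]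
    {F F' G : A ⥤ B} {H H' K : C ⥤ D} (hF : F = F') (hH : H = H') (α : F' ⟶ G) (β : H' ⟶ K) :
    NatTrans.prod (eqToHom hF ≫ α) (eqToHom hH ≫ β) = eqToHom (by rw [hF, hH]) ≫ NatTrans.prod α β := by
  subst hF hH
  simp only [eqToHom_refl, Category.id_comp]

/-- Two casts followed by a morphism are one cast followed by it. [folklore] -/
private theorem eqToHom_comp_eqToHom_comp {C : Type*} [Category C] {X Y Z W : C} (p : X = Y) (q : Y = Z) (f : Z ⟶ W) :
    eqToHom p ≫ eqToHom q ≫ f = eqToHom (p.trans q) ≫ f := by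
  cases p; cases q; simp

/-- **The untwisted `ι⊞` of the sum at `inl v`**: `iotaPre₁ × 𝟙`. [cite: MochizukiAbsTopIII2015, Def 5.4 (vii) p. 128] -/
theorem sum_iotaPre_inl (v : V₁) {ν₁ ν₂ : LogVertex (isArc₁ v)} (ε : LogEdgeLtimes (isArc₁ v) ν₁ ν₂)
    (h₁ : ν₁.isPostLog = false) :
    (Lt₁.sum Lt₂).iotaPre (.inl v) ε h₁ = NatTrans.prod (Lt₁.iotaPre v ε h₁) (𝟙 (𝟭 Lt₂.X)) := by
  refine iotaPre_eq_of_iota_eq (Lt₁.sum Lt₂) (Sum.inl v) ε h₁ _ ?_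
  rw [sum_iota_inl, Lt₁.iota_eq_eqToHom_comp_iotaPre' v ε h₁, Lt₂.twistToId_eq_eqToHom _ h₁,
    ← Category.comp_id (eqToHom (_ : frobeniusTwist Lt₂.log ν₁.isPostLog = 𝟭 Lt₂.X)), natTransProd_eqToHom_comp]
  exact eqToHom_comp_eqToHom_comp _ _ _

/-- **The untwisted `ι⊞` of the sum at `inr v`**: `𝟙 × iotaPre₂`. [cite: MochizukiAbsTopIII2015, Def 5.4 (vii) p. 128] -/
theorem sum_iotaPre_inr (v : V₂) {ν₁ ν₂ : LogVertex (isArc₂ v)} (ε : LogEdgeLtimes (isArc₂ v) ν₁ ν₂)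
    (h₁ : ν₁.isPostLog = false) :
    (Lt₁.sum Lt₂).iotaPre (.inr v) ε h₁ = NatTrans.prod (𝟙 (𝟭 Lt₁.X)) (Lt₂.iotaPre v ε h₁) := by
  refine iotaPre_eq_of_iota_eq (Lt₁.sum Lt₂) (Sum.inr v) ε h₁ _ ?_
  rw [sum_iota_inr, Lt₂.iota_eq_eqToHom_comp_iotaPre' v ε h₁, Lt₁.twistToId_eq_eqToHom _ h₁,
    ← Category.comp_id (eqToHom (_ : frobeniusTwist Lt₁.log ν₁.isPostLog = 𝟭 Lt₁.X)), natTransProd_eqToHom_comp]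
  exact eqToHom_comp_eqToHom_comp _ _ _

/-- `γ⁰` of the sum at `inl v`, first component = `γ⁰` of the first factor. [cite: MochizukiAbsTopIII2015, Cor 5.10 (iv)(c) p. 148] -/
theorem sum_gammaZeroApp_inl_fst (v : V₁) {ν₁ ν₂ : LogVertex (isArc₁ v)} (ε : LogEdgeTS (isArc₁ v) ν₁ ν₂)
    (hε : ε.InCore) (y : (Lt₁.sum Lt₂).X) :
    ((Lt₁.sum Lt₂).gammaZeroApp (.inl v) ε hε y).1 = Lt₁.gammaZeroApp v ε hε y.1 := by
  simp only [gammaZeroApp, iotaCore, sum_iotaPre_inl]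
  rfl

/-- … second component = an identity (the carried object does not move along `ι⊞` of the other factor).
[cite: MochizukiAbsTopIII2015, Cor 5.10 (iv)(c) p. 148] -/
theorem sum_gammaZeroApp_inl_snd (v : V₁) {ν₁ ν₂ : LogVertex (isArc₁ v)} (ε : LogEdgeTS (isArc₁ v) ν₁ ν₂)
    (hε : ε.InCore) (y : (Lt₁.sum Lt₂).X) :
    ((Lt₁.sum Lt₂).gammaZeroApp (.inl v) ε hε y).2 = 𝟙 ((Lt₂.proj ⋙ Lt₂.monoAn).obj y.2) := by
  simp only [gammaZeroApp, iotaCore, sum_iotaPre_inl]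
  exact (Lt₂.proj ⋙ Lt₂.monoAn).map_id _

/-- `γ⁰` of the sum at `inr v`, components. [cite: MochizukiAbsTopIII2015, Cor 5.10 (iv)(c) p. 148] -/
theorem sum_gammaZeroApp_inr_snd (v : V₂) {ν₁ ν₂ : LogVertex (isArc₂ v)} (ε : LogEdgeTS (isArc₂ v) ν₁ ν₂)
    (hε : ε.InCore) (y : (Lt₁.sum Lt₂).X) :
    ((Lt₁.sum Lt₂).gammaZeroApp (.inr v) ε hε y).2 = Lt₂.gammaZeroApp v ε hε y.2 := by
  simp only [gammaZeroApp, iotaCore, sum_iotaPre_inr]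
  rfl

/-- … first component = an identity. [cite: MochizukiAbsTopIII2015, Cor 5.10 (iv)(c) p. 148] -/
theorem sum_gammaZeroApp_inr_fst (v : V₂) {ν₁ ν₂ : LogVertex (isArc₂ v)} (ε : LogEdgeTS (isArc₂ v) ν₁ ν₂)
    (hε : ε.InCore) (y : (Lt₁.sum Lt₂).X) :
    ((Lt₁.sum Lt₂).gammaZeroApp (.inr v) ε hε y).1 = 𝟙 ((Lt₁.proj ⋙ Lt₁.monoAn).obj y.1) := by
  simp only [gammaZeroApp, iotaCore, sum_iotaPre_inr]
  exact (Lt₁.proj ⋙ Lt₁.monoAn).map_id _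

variable {Lt₁ Lt₂}
variable {K₁ : Lt₁.MonoTelecoreCoherence M₁} {K₂ : Lt₂.MonoTelecoreCoherence M₂}
  (I₁ : K₁.IotaData) (I₂ : K₂.IotaData)

/-- The `ι^{An⊢⊞}`-data of the sum's coherence add-on: `sumIotaAnMono`. [cite: MochizukiAbsTopIII2015, Prop 5.8 (vii) p. 142] -/
def sumIotaData : (sumMonoTelecoreCoherence K₁ K₂).IotaData := sumIotaAnMono I₁ I₂

/-- `γ¹` of the sum at `inl v`, first component = `γ¹` of the first factor. [cite: MochizukiAbsTopIII2015, Cor 5.10 (iv)(c) p. 148] -/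
theorem sum_gammaOneApp_inl_fst (v : V₁) {ν₁ ν₂ : LogVertex (isArc₁ v)} (ε : LogEdgeTS (isArc₁ v) ν₁ ν₂)
    (hε : ε.InCore) (y : (Lt₁.sum Lt₂).X) :
    ((sumIotaData I₁ I₂).gammaOneApp (.inl v) ε hε y).1 = I₁.gammaOneApp v ε hε y.1 := by
  simp only [IotaAnMono.gammaOneApp, iotaCore, sum_iotaPre_inl, sumIotaData, sumIotaAnMono_ι_inl]
  rfl

/-- … second component = an identity. [cite: MochizukiAbsTopIII2015, Cor 5.10 (iv)(c) p. 148] -/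
theorem sum_gammaOneApp_inl_snd (v : V₁) {ν₁ ν₂ : LogVertex (isArc₁ v)} (ε : LogEdgeTS (isArc₁ v) ν₁ ν₂)
    (hε : ε.InCore) (y : (Lt₁.sum Lt₂).X) :
    ((sumIotaData I₁ I₂).gammaOneApp (.inl v) ε hε y).2 =
      𝟙 ((Lt₂.proj ⋙ Lt₂.monoAn ⋙ Lt₂.κAnMono.functor ⋙ Lt₂.κAnMono.inverse).obj y.2) := by
  simp only [IotaAnMono.gammaOneApp, iotaCore, sum_iotaPre_inl, sumIotaData, sumIotaAnMono_ι_inl]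
  change Lt₂.κAnMono.inverse.map ((𝟭 Lt₂.X ⋙ Lt₂.proj ⋙ Lt₂.monoAn ⋙ Lt₂.κAnMono.functor).map (𝟙 y.2)) ≫ 𝟙 _ = 𝟙 _
  erw [CategoryTheory.Functor.map_id, CategoryTheory.Functor.map_id, Category.comp_id]

/-- `γ¹` of the sum at `inr v`, components. [cite: MochizukiAbsTopIII2015, Cor 5.10 (iv)(c) p. 148] -/
theorem sum_gammaOneApp_inr_snd (v : V₂) {ν₁ ν₂ : LogVertex (isArc₂ v)} (ε : LogEdgeTS (isArc₂ v) ν₁ ν₂)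
    (hε : ε.InCore) (y : (Lt₁.sum Lt₂).X) :
    ((sumIotaData I₁ I₂).gammaOneApp (.inr v) ε hε y).2 = I₂.gammaOneApp v ε hε y.2 := by
  simp only [IotaAnMono.gammaOneApp, iotaCore, sum_iotaPre_inr, sumIotaData, sumIotaAnMono_ι_inr]
  rfl

/-- … first component = an identity. [cite: MochizukiAbsTopIII2015, Cor 5.10 (iv)(c) p. 148] -/
theorem sum_gammaOneApp_inr_fst (v : V₂) {ν₁ ν₂ : LogVertex (isArc₂ v)} (ε : LogEdgeTS (isArc₂ v) ν₁ ν₂)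
    (hε : ε.InCore) (y : (Lt₁.sum Lt₂).X) :
    ((sumIotaData I₁ I₂).gammaOneApp (.inr v) ε hε y).1 =
      𝟙 ((Lt₁.proj ⋙ Lt₁.monoAn ⋙ Lt₁.κAnMono.functor ⋙ Lt₁.κAnMono.inverse).obj y.1) := by
  simp only [IotaAnMono.gammaOneApp, iotaCore, sum_iotaPre_inr, sumIotaData, sumIotaAnMono_ι_inr]
  change Lt₁.κAnMono.inverse.map ((𝟭 Lt₁.X ⋙ Lt₁.proj ⋙ Lt₁.monoAn ⋙ Lt₁.κAnMono.functor).map (𝟙 y.1)) ≫ 𝟙 _ = 𝟙 _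
  erw [CategoryTheory.Functor.map_id, CategoryTheory.Functor.map_id, Category.comp_id]

/-- ★ **The `η⊢`-square of Cor 5.10 (iv)(c) is inherited by the SUM**: if the squares commute for `(K₁, I₁)` over `V₁` and for
`(K₂, I₂)` over `V₂`, they commute for the sum over `V₁ ⊕ V₂` (at `inl v`: the first factor's square, and on the carried object
the trivial square `η ≫ 𝟙 = 𝟙 ≫ η`). [cite: MochizukiAbsTopIII2015, Cor 5.10 (iv)(c) p. 148] -/
theorem etaNatural_sum (h₁ : K₁.EtaNatural I₁) (h₂ : K₂.EtaNatural I₂) :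
    (sumMonoTelecoreCoherence K₁ K₂).EtaNatural (sumIotaData I₁ I₂) := by
  rintro (v | v) ν₁ ν₂ ε hε y
  · apply Prod.hom_ext
    · change ((K₁.eta v ν₁ hε.isCross_src).hom.app y.1 ≫ ((Lt₁.sum Lt₂).gammaZeroApp (.inl v) ε hε y).1) =
        ((sumIotaData I₁ I₂).gammaOneApp (.inl v) ε hε y).1 ≫ (K₁.eta v ν₂ hε.isCross_tgt).hom.app y.1
      rw [sum_gammaZeroApp_inl_fst, sum_gammaOneApp_inl_fst]
      exact h₁ v ε hε y.1
    · change (Lt₂.carriedEta.hom.app y.2 ≫ ((Lt₁.sum Lt₂).gammaZeroApp (.inl v) ε hε y).2) =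
        ((sumIotaData I₁ I₂).gammaOneApp (.inl v) ε hε y).2 ≫ Lt₂.carriedEta.hom.app y.2
      rw [sum_gammaZeroApp_inl_snd, sum_gammaOneApp_inl_snd]
      erw [Category.comp_id, Category.id_comp]
  · apply Prod.hom_ext
    · change (Lt₁.carriedEta.hom.app y.1 ≫ ((Lt₁.sum Lt₂).gammaZeroApp (.inr v) ε hε y).1) =
        ((sumIotaData I₁ I₂).gammaOneApp (.inr v) ε hε y).1 ≫ Lt₁.carriedEta.hom.app y.1
      rw [sum_gammaZeroApp_inr_fst, sum_gammaOneApp_inr_fst]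
      erw [Category.comp_id, Category.id_comp]
    · change ((K₂.eta v ν₁ hε.isCross_src).hom.app y.2 ≫ ((Lt₁.sum Lt₂).gammaZeroApp (.inr v) ε hε y).2) =
        ((sumIotaData I₁ I₂).gammaOneApp (.inr v) ε hε y).2 ≫ (K₂.eta v ν₂ hε.isCross_tgt).hom.app y.2
      rw [sum_gammaZeroApp_inr_snd, sum_gammaOneApp_inr_snd]
      exact h₂ v ε hε y.2

end EtaSquare

/-! ## §3. (dropped) — the frozen-carrier instances `twoPrimeOpen`, `genuineTwoSidedSum` of the original are NOT ported here (recipe rule 6);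
the `⋉`-carriers are built in `Ltimes/LogFrobeniusSettingSumLtimesCarriers.lean`. -/

end LogFrobeniusSettingLtimes

end Literature.AnabelianGeometry.AbsoluteAnabelian

end
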